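import Mathlib
import Literature.Analysis.Convexity.AnisotropicPerimeter
import Literature.MeasureTheory.Integral.HPolytopeGaussGreen
import Literature.MeasureTheory.Integral.EuclideanDivergenceCoords
import HarnessLib

/-!
# The anisotropic perimeter of a convex polytope is at most its facet sum `Σ_F h_K(ν_F)·area(F)`

Topic `Literature/Analysis/Convexity`; namespace `Literature.Analysis.Convexity`.
Upper half (T2b of the facet-formula programme, crystal3d-full eng MEMO-5/6) of the facet formula for
the tree's distributional anisotropic perimeter `anisotropicPerimeter K A = sup {∫_A div φ : φ ∈ C¹_c,
φ(x) ∈ K}`: for a compact H-polytope `P ⊆ ℝ³` (unit, pairwise non-proportional constraints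
`⟪a_j, x⟫ ≤ b_j`, both signs in every coordinate direction) with isometric facet charts
`Φ_j y = p_j + y₁U_j + y₂V_j`, and a compact constraint body `K`,
`P_K(P) ≤ Σ_{j ∈ J} h_K(a_j) · area_j`, `h_K(a_j) = sup_{k ∈ K} ⟪a_j, k⟫`,
`area_j = |{y | Φ_j y ∈ P}|` (the area of the `j`-th facet read in its chart; zero for redundant
constraints) — `anisotropicPerimeter_hPolytope_le_facetSum`.  Proof: Gauss–Green for polytopes
(`setIntegral_divergence_hPolytope_eq_facetSum`, T1) after passing to coordinates
(`setIntegral_fieldDivergence_eq_coords`, T2a), then `⟪a_j, φ⟫ ≤ h_K(a_j)` on each facet.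
The lower half (`≥`, cut-off fields per facet) and finite unions are NOT here.
-/

noncomputable section

namespace Literature.Analysis.Convexity

open _root_.MeasureTheory Set Finset
open Literature.MathematicalPhysics.StatisticalMechanics (fieldDivergence)
open Literature.MeasureTheory.Integral

variable {ι : Type*} [LinearOrder ι]

/-- The chart preimage of a bounded set under an isometric facet chart is bounded: if `Σ U_l² = 1`,
`Σ V_l² = 1`, `Σ U_l V_l = 0` and `‖x‖ ≤ R` on `P`, then `{y | p + y₁U + y₂V ∈ P}` lies in the closed
ball of radius `3(R + ‖p‖)`. [cite: EvansGariepy2015, Thm 5.16 (Gauss–Green) — plumbing] -/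
theorem chartPreimage_subset_closedBall {P : Set (Fin 3 → ℝ)} {R : ℝ} (hR : ∀ x ∈ P, ‖x‖ ≤ R)
    (p U V : Fin 3 → ℝ) (hU1 : ∑ l, U l ^ 2 = 1) (hV1 : ∑ l, V l ^ 2 = 1)
    (hUV : ∑ l, U l * V l = 0) :
    {y : ℝ × ℝ | p + y.1 • U + y.2 • V ∈ P} ⊆ Metric.closedBall 0 (3 * (R + ‖p‖)) := by
  intro y hy
  have hyP : p + y.1 • U + y.2 • V ∈ P := hy
  have hRp : 0 ≤ R := (norm_nonneg _).trans (hR _ hyP)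
  -- coordinates recovered by orthonormality
  have e1 : y.1 = ∑ l, U l * ((p + y.1 • U + y.2 • V) l - p l) := by
    have : ∀ l, (p + y.1 • U + y.2 • V) l - p l = y.1 * U l + y.2 * V l := by
      intro l; simp [smul_eq_mul]; ring
    simp_rw [this, mul_add, Finset.sum_add_distrib]
    have h1 : ∑ l, U l * (y.1 * U l) = y.1 * ∑ l, U l ^ 2 := by
      rw [Finset.mul_sum]; exact Finset.sum_congr rfl fun l _ => by ring
    have h2 : ∑ l, U l * (y.2 * V l) = y.2 * ∑ l, U l * V l := by
      rw [Finset.mul_sum]; exact Finset.sum_congr rfl fun l _ => by ring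
    rw [h1, h2, hU1, hUV]; ring
  have e2 : y.2 = ∑ l, V l * ((p + y.1 • U + y.2 • V) l - p l) := by
    have : ∀ l, (p + y.1 • U + y.2 • V) l - p l = y.1 * U l + y.2 * V l := by
      intro l; simp [smul_eq_mul]; ring
    simp_rw [this, mul_add, Finset.sum_add_distrib]
    have h1 : ∑ l, V l * (y.1 * U l) = y.1 * ∑ l, U l * V l := by
      rw [Finset.mul_sum]; exact Finset.sum_congr rfl fun l _ => by ring
    have h2 : ∑ l, V l * (y.2 * V l) = y.2 * ∑ l, V l ^ 2 := by
      rw [Finset.mul_sum]; exact Finset.sum_congr rfl fun l _ => by ring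
    rw [h1, h2, hV1, hUV]; ring
  -- each coordinate of a unit vector is at most `1` in absolute value
  have hUl : ∀ l, |U l| ≤ 1 := fun l => by
    have : U l ^ 2 ≤ 1 := by
      rw [← hU1]; exact Finset.single_le_sum (fun k _ => sq_nonneg (U k)) (Finset.mem_univ l)
    exact abs_le_one_iff_mul_self_le_one.2 (by nlinarith)
  have hVl : ∀ l, |V l| ≤ 1 := fun l => by
    have : V l ^ 2 ≤ 1 := by
      rw [← hV1]; exact Finset.single_le_sum (fun k _ => sq_nonneg (V k)) (Finset.mem_univ l)
    exact abs_le_one_iff_mul_self_le_one.2 (by nlinarith)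
  have hdl : ∀ l, |(p + y.1 • U + y.2 • V) l - p l| ≤ R + ‖p‖ := by
    intro l
    have h1 : |(p + y.1 • U + y.2 • V) l| ≤ R :=
      (norm_le_pi_norm (p + y.1 • U + y.2 • V) l).trans (hR _ hyP)
    have h2 : |p l| ≤ ‖p‖ := norm_le_pi_norm p l
    calc |(p + y.1 • U + y.2 • V) l - p l| ≤ |(p + y.1 • U + y.2 • V) l| + |p l| := abs_sub _ _
      _ ≤ R + ‖p‖ := add_le_add h1 h2
  have hb1 : |y.1| ≤ 3 * (R + ‖p‖) := by
    rw [e1]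
    calc |∑ l, U l * ((p + y.1 • U + y.2 • V) l - p l)|
        ≤ ∑ l, |U l * ((p + y.1 • U + y.2 • V) l - p l)| := Finset.abs_sum_le_sum_abs _ _
      _ ≤ ∑ _l : Fin 3, (R + ‖p‖) := Finset.sum_le_sum fun l _ => by
          rw [abs_mul]
          calc |U l| * |(p + y.1 • U + y.2 • V) l - p l| ≤ 1 * (R + ‖p‖) :=
                mul_le_mul (hUl l) (hdl l) (abs_nonneg _) zero_le_one
            _ = R + ‖p‖ := one_mul _
      _ = 3 * (R + ‖p‖) := by simp; ring
  have hb2 : |y.2| ≤ 3 * (R + ‖p‖) := by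
    rw [e2]
    calc |∑ l, V l * ((p + y.1 • U + y.2 • V) l - p l)|
        ≤ ∑ l, |V l * ((p + y.1 • U + y.2 • V) l - p l)| := Finset.abs_sum_le_sum_abs _ _
      _ ≤ ∑ _l : Fin 3, (R + ‖p‖) := Finset.sum_le_sum fun l _ => by
          rw [abs_mul]
          calc |V l| * |(p + y.1 • U + y.2 • V) l - p l| ≤ 1 * (R + ‖p‖) :=
                mul_le_mul (hVl l) (hdl l) (abs_nonneg _) zero_le_one
            _ = R + ‖p‖ := one_mul _
      _ = 3 * (R + ‖p‖) := by simp; ring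
  rw [Metric.mem_closedBall, dist_zero_right, Prod.norm_def]
  exact max_le (by simpa [Real.norm_eq_abs] using hb1) (by simpa [Real.norm_eq_abs] using hb2)

/-- **Upper facet bound for the anisotropic perimeter of a convex polytope** (see the module docstring):
`P_K(P) ≤ Σ_j h_K(a_j) · area_j`.
[cite: EvansGariepy2015, Thm 5.16 (Gauss–Green), polyhedral case; Maggi2012, (20.2) p. 258] -/
theorem anisotropicPerimeter_hPolytope_le_facetSum {J : Finset ι}
    (a : ι → Fin 3 → ℝ) (b : ι → ℝ) (ha1 : ∀ j ∈ J, ∑ l, a j l ^ 2 = 1)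
    (hbd : ∀ i : Fin 3,
      (J.filter fun j => 0 < a j i).Nonempty ∧ (J.filter fun j => a j i < 0).Nonempty)
    (hnd : ∀ j ∈ J, ∀ k ∈ J, j ≠ k → ¬ ∃ μ : ℝ, (∀ l, a k l = μ * a j l) ∧ b k = μ * b j)
    (p U V : ι → Fin 3 → ℝ) (hp : ∀ j ∈ J, ∑ l, a j l * p j l = b j)
    (hU : ∀ j ∈ J, ∑ l, a j l * U j l = 0) (hV : ∀ j ∈ J, ∑ l, a j l * V j l = 0)
    (hU1 : ∀ j ∈ J, ∑ l, U j l ^ 2 = 1) (hV1 : ∀ j ∈ J, ∑ l, V j l ^ 2 = 1)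
    (hUV : ∀ j ∈ J, ∑ l, U j l * V j l = 0)
    (hPc : IsCompact {x : Fin 3 → ℝ | ∀ j ∈ J, ∑ l, a j l * x l ≤ b j})
    {K : Set (EuclideanSpace ℝ (Fin 3))} (hK : IsCompact K) :
    anisotropicPerimeter K {z : EuclideanSpace ℝ (Fin 3) | ∀ j ∈ J, ∑ l, a j l * z l ≤ b j} ≤
      ENNReal.ofReal (∑ j ∈ J,
        sSup ((fun k : EuclideanSpace ℝ (Fin 3) => ∑ l, a j l * k l) '' K) *
          (volume {y : ℝ × ℝ | p j + y.1 • U j + y.2 • V j ∈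
            {x : Fin 3 → ℝ | ∀ j ∈ J, ∑ l, a j l * x l ≤ b j}}).toReal) := by
  classical
  set P : Set (Fin 3 → ℝ) := {x | ∀ j ∈ J, ∑ l, a j l * x l ≤ b j} with hP
  have hpre : (WithLp.toLp 2 : (Fin 3 → ℝ) → EuclideanSpace ℝ (Fin 3)) ⁻¹'
      {z : EuclideanSpace ℝ (Fin 3) | ∀ j ∈ J, ∑ l, a j l * z l ≤ b j} = P := by
    ext x; simp [hP]
  unfold anisotropicPerimeter
  refine iSup₂_le fun φ hφ => ?_
  obtain ⟨hφ1, hφc, hφK⟩ := hφ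
  apply ENNReal.ofReal_le_ofReal
  -- pass to coordinates and apply Gauss–Green for polytopes
  rw [setIntegral_fieldDivergence_eq_coords, hpre,
    setIntegral_divergence_hPolytope_eq_facetSum a b ha1 hbd hnd p U V hp hU hV hU1 hV1 hUV hPc
      (η := fun i x => (φ (WithLp.toLp 2 x)) i)
      (dη := fun i x => (fderiv ℝ φ (WithLp.toLp 2 x) (EuclideanSpace.single i 1)) i)
      (fun i => continuous_apply_toLp hφ1.continuous i)
      (fun i => continuous_fderiv_apply_toLp hφ1 i) (fun i x => hasDerivAt_apply_toLp_update hφ1 i x)]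
  refine Finset.sum_le_sum fun j hj => ?_
  -- the `j`-th facet
  set S : Set (ℝ × ℝ) := {y | p j + y.1 • U j + y.2 • V j ∈ P} with hS
  have hΦc : Continuous fun y : ℝ × ℝ => p j + y.1 • U j + y.2 • V j := by fun_prop
  have hSclosed : IsClosed S := hPc.isClosed.preimage hΦc
  have hSmeas : MeasurableSet S := hSclosed.measurableSet
  obtain ⟨R, hR⟩ : ∃ R, ∀ x ∈ P, ‖x‖ ≤ R := by
    obtain ⟨R, hR⟩ := hPc.isBounded.subset_closedBall 0
    exact ⟨R, fun x hx => by simpa using hR hx⟩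
  have hSbdd : Bornology.IsBounded S :=
    (Metric.isBounded_closedBall).subset
      (chartPreimage_subset_closedBall hR (p j) (U j) (V j) (hU1 j hj) (hV1 j hj) (hUV j hj))
  have hScpt : IsCompact S := Metric.isCompact_of_isClosed_isBounded hSclosed hSbdd
  have hSfin : volume S < ⊤ := hSbdd.measure_lt_top
  -- the bound `h_K(a_j)` on the facet
  set hKj : ℝ := sSup ((fun k : EuclideanSpace ℝ (Fin 3) => ∑ l, a j l * k l) '' K) with hhKj
  have hbdd : BddAbove ((fun k : EuclideanSpace ℝ (Fin 3) => ∑ l, a j l * k l) '' K) := by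
    refine (hK.image ?_).bddAbove
    exact continuous_finsetSum _ fun l _ => continuous_const.mul (PiLp.continuous_apply 2 _ l)
  have hle : ∀ z : EuclideanSpace ℝ (Fin 3), z ∈ K → ∑ l, a j l * z l ≤ hKj :=
    fun z hz => le_csSup hbdd ⟨z, hz, rfl⟩
  -- integrability of the facet integrands
  have hfi : ∀ i, Integrable (fun y : ℝ × ℝ => P.indicator (fun _ => (1 : ℝ)) (p j + y.1 • U j + y.2 • V j) *
      (φ (WithLp.toLp 2 (p j + y.1 • U j + y.2 • V j))) i) := by
    intro i
    have hind : (fun y : ℝ × ℝ => P.indicator (fun _ => (1 : ℝ)) (p j + y.1 • U j + y.2 • V j) *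
        (φ (WithLp.toLp 2 (p j + y.1 • U j + y.2 • V j))) i) =
        S.indicator (fun y => (φ (WithLp.toLp 2 (p j + y.1 • U j + y.2 • V j))) i) := by
      funext y
      by_cases hy : p j + y.1 • U j + y.2 • V j ∈ P
      · rw [Set.indicator_of_mem hy, Set.indicator_of_mem (show y ∈ S from hy), one_mul]
      · rw [Set.indicator_of_notMem hy, Set.indicator_of_notMem (show y ∉ S from hy), zero_mul]
    rw [hind, integrable_indicator_iff hSmeas]
    exact ((continuous_apply_toLp hφ1.continuous i).comp hΦc).continuousOn.integrableOn_compact hScpt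
  -- merge the sum over `i` into one integral and bound pointwise
  have hsum : ∑ i, a j i * ∫ y : ℝ × ℝ, P.indicator (fun _ => (1 : ℝ)) (p j + y.1 • U j + y.2 • V j) *
      (φ (WithLp.toLp 2 (p j + y.1 • U j + y.2 • V j))) i =
      ∫ y : ℝ × ℝ, ∑ i, a j i * (P.indicator (fun _ => (1 : ℝ)) (p j + y.1 • U j + y.2 • V j) *
        (φ (WithLp.toLp 2 (p j + y.1 • U j + y.2 • V j))) i) := by
    rw [integral_finsetSum _ (fun i _ => (hfi i).const_mul (a j i))]
    refine Finset.sum_congr rfl fun i _ => (integral_const_mul _ _).symm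
  have hpt : ∀ y : ℝ × ℝ, ∑ i, a j i * (P.indicator (fun _ => (1 : ℝ)) (p j + y.1 • U j + y.2 • V j) *
      (φ (WithLp.toLp 2 (p j + y.1 • U j + y.2 • V j))) i) ≤ S.indicator (fun _ => hKj) y := by
    intro y
    by_cases hy : p j + y.1 • U j + y.2 • V j ∈ P
    · rw [Set.indicator_of_mem (show y ∈ S from hy)]
      simp only [Set.indicator_of_mem hy, one_mul]
      exact hle _ (hφK _)
    · rw [Set.indicator_of_notMem (show y ∉ S from hy)]
      simp only [Set.indicator_of_notMem hy, zero_mul, mul_zero, Finset.sum_const_zero, le_refl]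
  have hIconst : Integrable (S.indicator fun _ : ℝ × ℝ => hKj) := by
    rw [integrable_indicator_iff hSmeas]; exact integrableOn_const hSfin.ne
  rw [hsum]
  calc ∫ y : ℝ × ℝ, ∑ i, a j i * (P.indicator (fun _ => (1 : ℝ)) (p j + y.1 • U j + y.2 • V j) *
        (φ (WithLp.toLp 2 (p j + y.1 • U j + y.2 • V j))) i)
      ≤ ∫ y : ℝ × ℝ, S.indicator (fun _ => hKj) y :=
        integral_mono (integrable_finsetSum _ fun i _ => (hfi i).const_mul (a j i)) hIconst hpt
    _ = (volume S).toReal * hKj := by rw [integral_indicator_const _ hSmeas, smul_eq_mul, measureReal_def]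
    _ = hKj * (volume S).toReal := mul_comm _ _

end Literature.Analysis.Convexity

end
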